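import Mathlib.LinearAlgebra.Matrix.Nondegenerate
import Mathlib.Tactic.IntervalCases
import Mathlib.Tactic.FinCases
import Mathlib.Tactic.FieldSimp
import HarnessLib

/-!
# The four-sheet matrix: monomial `σ`-intertwiners, the zero case, and the nonsingular case

COR-CM (cell `pub-hodgecm2`), binder seat b04 (gen 26), count-neutral claim CYCLIC-SEMIDIRECT-RESIDUE, part Q-Ib — pure
`4 × 4` linear algebra over a field `L` with a ring endomorphism `σ`, feeding the four-sheet model theorem
(`CorCM/GaloisCyclicSemidirectTwoPowerQuarticFourSheet`) into the semilinear kernel trick (`CorCM/SemilinearKernelNorm`).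
KERNEL ONLY: theorems; no definition, no named fact, no `sorry`.  `HC_CM` is neither used nor claimed.

THE MATRIX.  For `δ < 4`, sheet sums `s_0, …, s_3 ∈ L` with `σ⁴(s_j) = s_j` and a `σ`-fixed unit `ω`,
  `M^{(δ)}_{ik} = ω^{[i + j ≥ 4]} · σ^k(s_j)`, `j = (k + δ − i) mod 4` (`i, k < 4`)
— the matrix of the `δ`-th transformed four-sheet system of `CorCM/FourSheetAnnihilator` (`eq_zero_of_fourSheet`, unknowns
`u_k`).  With the cyclic shift `Π` (`Π_{i,i+1} = 1`), `C_δ = diag(ω at k = 3 − δ, else 1)`, `R = diag(1,1,1,ω⁻¹)`: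
  `M P = P' σ(M)`, `P = Π⁻¹ C_δ⁻¹`, `P' = Π⁻¹ R`, and `P σ(P) σ²(P) σ³(P) = P⁴ = ω⁻¹ · 1`
(checked entrywise, `interval_cases δ`, `fin_cases`).

* `fourSheet_mul_eq_mul_map` — `M P = P' σ(M)`.
* `P_mul_map_eq` — `P σ(P) σ²(P) σ³(P) = ω⁻¹ • 1`.
* `sheetSum_eq_zero_of_fourSheet_eq_zero` — `M = 0 ⟹ s_j = 0` for all `j < 4`.
* `apply_eq_zero_of_det_ne_zero` — the sum-form system is `M u = 0`; `det M ≠ 0 ⟹ u = 0`.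

## References

* [Pierce1982] R. S. Pierce, *Associative Algebras*, GTM 88, Springer 1982, §15.1 (cyclic algebras, the norm criterion).
* [Kubota1965] T. Kubota, Nagoya Math. J. 25 (1965) 113–120, §4 Lemma 2.
-/

open scoped BigOperators

namespace Summit.HodgeConjecture.CorCM.GaloisCyclicSemidirectTwoPowerQuartic

section Matrix4

variable {L : Type*} [Field L]

/-- The four-sheet matrix `M^{(δ)}_{ik} = ω^{[i + j ≥ 4]} σ^k(s_j)` (`j ≡ k + δ − i (mod 4)`) is intertwined with its
`σ`-conjugate by monomial matrices: `M P = P' σ(M)`, `P = Π⁻¹ C_δ⁻¹`, `P' = Π⁻¹ R`. [cite: Pierce1982, §15.1] -/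
theorem fourSheet_mul_eq_mul_map (σ : L →+* L) (ω : L) (hω : ω ≠ 0) (hσω : σ ω = ω) (s : ℕ → L)
    (hσ4 : ∀ j, σ (σ (σ (σ (s j)))) = s j) (δ : ℕ) (hδ : δ < 4) (M P P' : Matrix (Fin 4) (Fin 4) L)
    (hM : ∀ i k : Fin 4, M i k = (if (i : ℕ) + (((k : ℕ) + δ + 4 - i) % 4) < 4 then 1 else ω) *
      σ^[k] (s (((k : ℕ) + δ + 4 - i) % 4)))
    (hP : ∀ i k : Fin 4, P i k = if (i : ℕ) = ((k : ℕ) + 1) % 4 then (if (k : ℕ) = 3 - δ then ω⁻¹ else 1) else 0)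
    (hP' : ∀ i k : Fin 4, P' i k = if (i : ℕ) = ((k : ℕ) + 1) % 4 then (if (k : ℕ) = 3 then ω⁻¹ else 1) else 0) :
    M * P = P' * M.map σ := by
  have hσω' : σ ω⁻¹ = ω⁻¹ := by rw [map_inv₀, hσω]
  interval_cases δ <;>
  · ext i k
    fin_cases i <;> fin_cases k <;>
      · simp [Matrix.mul_apply, Fin.sum_univ_four, hM, hP, hP', Function.iterate_succ_apply', hσω, hσ4]
        try field_simp

/-- The monomial matrix `P = Π⁻¹ C_δ⁻¹` is `σ`-invariant and `P σ(P) σ²(P) σ³(P) = P⁴ = ω⁻¹ · 1`. [cite: Pierce1982, §15.1] -/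
theorem P_mul_map_eq (σ : L →+* L) (ω : L) (hσω : σ ω = ω) (δ : ℕ) (hδ : δ < 4)
    (P : Matrix (Fin 4) (Fin 4) L)
    (hP : ∀ i k : Fin 4, P i k = if (i : ℕ) = ((k : ℕ) + 1) % 4 then (if (k : ℕ) = 3 - δ then ω⁻¹ else 1) else 0) :
    P * P.map σ * P.map (σ.comp σ) * P.map (σ.comp (σ.comp σ)) = ω⁻¹ • (1 : Matrix (Fin 4) (Fin 4) L) := by
  have hσω' : σ ω⁻¹ = ω⁻¹ := by rw [map_inv₀, hσω]
  have hmap : ∀ τ : L →+* L, τ ω⁻¹ = ω⁻¹ → P.map τ = P := fun τ hτ => by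
    ext i k
    simp only [Matrix.map_apply, hP]
    split_ifs <;> simp [hτ]
  rw [hmap σ hσω', hmap (σ.comp σ) (by simp [hσω]), hmap (σ.comp (σ.comp σ)) (by simp [hσω])]
  interval_cases δ <;>
  · ext i k
    fin_cases i <;> fin_cases k <;>
      simp [Matrix.mul_apply, Fin.sum_univ_four, hP, Matrix.smul_apply]

/-- If the four-sheet matrix vanishes then all four sheet sums vanish (read off the column `k = 0`). [folklore] -/
theorem sheetSum_eq_zero_of_fourSheet_eq_zero (σ : L →+* L) (ω : L) (hω : ω ≠ 0) (s : ℕ → L) (δ : ℕ) (hδ : δ < 4)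
    (M : Matrix (Fin 4) (Fin 4) L)
    (hM : ∀ i k : Fin 4, M i k = (if (i : ℕ) + (((k : ℕ) + δ + 4 - i) % 4) < 4 then 1 else ω) *
      σ^[k] (s (((k : ℕ) + δ + 4 - i) % 4)))
    (h0 : M = 0) : ∀ j, j < 4 → s j = 0 := by
  intro j hj
  -- the entry `(i, 0)` with `i ≡ δ − j (mod 4)` is `ω^{…} · s_j`
  have hi : (δ + 4 - j) % 4 < 4 := Nat.mod_lt _ (by norm_num)
  have h := hM ⟨(δ + 4 - j) % 4, hi⟩ ⟨0, by norm_num⟩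
  rw [h0, Matrix.zero_apply] at h
  have hjj : ((0 : ℕ) + δ + 4 - (δ + 4 - j) % 4) % 4 = j := by omega
  simp only [hjj, Function.iterate_zero, id_eq] at h
  rcases mul_eq_zero.1 h.symm with h1 | h1
  · split_ifs at h1 with hlt
    · exact absurd h1 one_ne_zero
    · exact absurd h1 hω
  · exact h1

/-- The four-sheet system in the form of `FourSheet.eq_zero_of_fourSheet` is `M^{(δ)} u = 0` for the four-sheet
matrix; if `det M^{(δ)} ≠ 0` then `u = 0`. [folklore] -/
theorem apply_eq_zero_of_det_ne_zero (ε : ℕ → ℕ → L) (S : ℕ → ℕ → L) (δ : ℕ) (hδ : δ < 4) (u : ℕ → L)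
    (hsys : ∀ i₀, i₀ < 4 → ∑ j ∈ Finset.range 4, ε i₀ j * S j ((i₀ + j + 4 - δ) % 4) * u ((i₀ + j + 4 - δ) % 4) = 0)
    (M : Matrix (Fin 4) (Fin 4) L)
    (hM : ∀ i k : Fin 4, M i k = ε i (((k : ℕ) + δ + 4 - i) % 4) * S (((k : ℕ) + δ + 4 - i) % 4) k)
    (hdet : M.det ≠ 0) : ∀ k, k < 4 → u k = 0 := by
  have hvec : M.mulVec (fun k : Fin 4 => u k) = 0 := by
    funext i
    rw [Matrix.mulVec, Pi.zero_apply]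
    change ∑ k : Fin 4, M i k * u k = 0
    rw [← hsys i i.isLt]
    -- reindex `k ↦ j = (k + δ − i) mod 4`
    refine Finset.sum_nbij' (fun k : Fin 4 => ((k : ℕ) + δ + 4 - i) % 4) (fun j => ⟨(i + j + 4 - δ) % 4, Nat.mod_lt _ (by norm_num)⟩)
      (fun k _ => Finset.mem_range.2 (Nat.mod_lt _ (by norm_num))) (fun j _ => Finset.mem_univ _)
      (fun k _ => ?_) (fun j hj => ?_) (fun k _ => ?_)
    · have hk := k.isLt
      exact Fin.ext (by simp only; omega)
    · rw [Finset.mem_range] at hj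
      have hi := i.isLt
      simp only
      omega
    · have hk := k.isLt
      have hi := i.isLt
      have e1 : ((i : ℕ) + (((k : ℕ) + δ + 4 - i) % 4) + 4 - δ) % 4 = k := by omega
      rw [hM, e1]
  intro k hk
  have h := Matrix.eq_zero_of_mulVec_eq_zero hdet hvec
  exact congrFun h ⟨k, hk⟩

end Matrix4

end Summit.HodgeConjecture.CorCM.GaloisCyclicSemidirectTwoPowerQuartic
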